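import Summits.BirchSwinnertonDyer.BirchSwinnertonDyer.Theorems.ResidualThetaTransportAtTwoResidualLayerAscends
import Literature.NumberTheory.EllipticCurves.TwoVariableAnticyclotomicControl
import Literature.NumberTheory.EllipticCurves.SubgroupSelmerProofs
import Literature.NumberTheory.EllipticCurves.H1UnramifiedFinite
import HarnessLib

/-!
# Restriction onto the invariants when the subgroup has no fixed points: `res : H¹(B, M) ⥲ H¹(A, M)^B` for `M^A = 0`,
# and the habitat instance `H¹(Γ_{ℚ_∞}, W[2]) ⥲ H¹(Γ_{ℚ_∞} ∩ N, W[2])^{Γ_{ℚ_∞}}` for every index-`2` subgroup `N ≤ Γ_ℚ`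
# (lead prover bsd-wall-rtt-p2 g10; `--supports stmt-BirchSwinnertonDyer-26074`; route-independent, closes nothing)

HONEST FRAMING. THEOREMS ONLY (no definition, no named fact, no `sorry`); nothing about any curve's Selmer group or any count
is asserted; BSD is not proved by any of this. No route (`Theses`) file is imported.

WHAT. Every CM-endpoint lever filed on the crux `(R≥)ᵖ` `ResidualThetaCountLowerPureAtTwo` (item stmt-BirchSwinnertonDyer-26074;
cards `gl1-plus-selmer-jlk-basechange` (T1), `character-side-signed-transport` (T1/`InfResInjective`),
`kolyvagin-rigidity-residual-primitivity`) begins by moving the residual object `H¹(ℚ_∞, W[2])` to the CM field side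
`K_∞ = K·ℚ_∞` (`K = ℚ(√Δ_W)`, `[K_∞ : ℚ_∞] = 2`): "`H¹(ℚ_∞, W[2]) = H¹(K_∞, W[2])^{c}`, inflation kernel `H¹(C₂, W[2]^{G_{K_∞}}) = 0`
and `H²`-obstruction `0` because `W[2]^{G_{K_∞}} = 0`". This file is that step, kernel-checked, in two layers:

§1 (generic: topological group `G`, discrete `G`-module `M`, subgroups `A ≤ B ≤ G` with `A` normal in `G`):
* `exists_resOfLe_eq_of_forall_conjH1_eq_of_fixed_eq_zero` — **if `M^A = 0` and `A` is relatively open in `B`, every class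
  of `H¹(A, M)` fixed by `conj_g` for all `g ∈ B` is a restriction from `H¹(B, M)`** (the surjectivity half of
  `0 → H¹(B/A, M^A) → H¹(B, M) → H¹(A, M)^{B/A} → H²(B/A, M^A)` when `M^A = 0`; NO index or coprimality hypothesis — the tree's
  `exists_resOfLe_eq_of_forall_conjH1_eq` needs `[B : A]` invertible on `M`, which fails here: index `2 =` characteristic).
  Proof on cocycles: invariance gives, for each `g ∈ B`, an `m_g ∈ M` with `g·z(g⁻¹ a g) − z(a) = a·m_g − m_g`; `M^A = 0` makes
  `m_g` unique, whence `m_a = z(a)` on `A` and `m_{gh} = m_g + g·m_h`; `g ↦ m_g` is the extension.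
* `eq_zero_of_forall_inf_smul_eq_of_index_two` — **`M^K = 0 ⟹ M^{K ∩ N} = 0`** for an elementary abelian `2`-group `M` and
  any subgroup `N` of index `2` (the `2`-group `K/(K ∩ N)` would have a fixed vector on `M^{K ∩ N} ≠ 0`).

§2 (habitat: `W/ℚ` globally minimal with `GoodSS W 2`, `κ` ANY `ℤ₂`-extension, `N ≤ Γ_ℚ` ANY subgroup of index `2` — e.g. `Γ_K`):
* `eq_zero_of_forall_kerSubgroup_inf_smul_eq` — `W[2]^{Γ_{ℚ_∞} ∩ N} = 0` (from g9's `W[2]^{Γ_{ℚ_∞}} = 0`, p613876);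
* `resOfLe_kerSubgroup_inf_injective` — `res : H¹(Γ_{ℚ_∞}, W[2]) → H¹(Γ_{ℚ_∞} ∩ N, W[2])` is injective;
* `exists_resOfLe_kerSubgroup_inf_eq_of_forall_conjH1_eq` — and ONTO the `Γ_{ℚ_∞}`-invariant classes (for `N` open);
* `resOfLe_kerSubgroup_inf_bijective_invariants` — packaged: `res` is a bijection onto `{y | ∀ g ∈ Γ_{ℚ_∞}, conj_g y = y}`.
Here `W[2] = (W.geomPrimaryTorsion 2)[2]`, the carrier of the crux. The local conditions (unramified outside `S₀`, plus-Kummer at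
`2`) are NOT treated here — that matching is line-specific.

References: [SerreLocalFields1979] VII.§6 Prop. 4–5 (inflation–restriction); [SerreGaloisCohomology1997] I.§2.6(b);
[NeukirchSchmidtWingberg2008] (1.6.6)–(1.6.7); [GreenbergLNM1716] §3 Lemma 3.1 (the shape `ker = H¹(Γ, M^{H})`).
-/

set_option autoImplicit false
-- D-0017: single-problem summit, so `Summit.BirchSwinnertonDyer.BirchSwinnertonDyer.…` repeats a namespace BY DESIGN.
set_option linter.dupNamespace false

noncomputable section

open scoped Classical AddSubgroup

open Literature.NumberTheory.EllipticCurves Literature.NumberTheory.GaloisRepresentations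

namespace Summit.BirchSwinnertonDyer.BirchSwinnertonDyer.Theorems.ResidualLayer

universe u

/-! ## §1. Generic: restriction onto the invariants when `M^A = 0` -/

section Generic

variable {G : Type u} [Group G] [TopologicalSpace G] [IsTopologicalGroup G]
  {M : Type u} [AddCommGroup M] [DistribMulAction G M] [TopologicalSpace M] [DiscreteTopology M]

omit [TopologicalSpace M] [DiscreteTopology M] in
/-- The compatibility of the pair `(σ⁻¹ (·) σ, σ • ·)` defining `conjH1` (generic restatement of the tree's
`ZpExtension.conj_compat`). [cite: SerreGaloisCohomology1997, I.§2.5] -/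
theorem conj_compat (A : Subgroup G) [A.Normal] (σ : G) (x : A) (v : M) :
    DistribSMul.toAddMonoidHom M σ (subgroupConj A σ x • v) = x • DistribSMul.toAddMonoidHom M σ v := by
  simp only [DistribSMul.toAddMonoidHom_apply, Subgroup.smul_def, subgroupConj_apply_coe, smul_smul,
    mul_assoc, mul_inv_cancel_left]

omit [TopologicalSpace G] [IsTopologicalGroup G] [TopologicalSpace M] [DiscreteTopology M] in
/-- Uniqueness of the "coboundary witness" when `M^A = 0`: if `a·m − m = a·m' − m'` for all `a ∈ A` then `m = m'`.
[cite: SerreLocalFields1979, VII.§6 (proof of Prop. 4)] -/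
theorem eq_of_forall_smul_sub_eq {A : Subgroup G} (hfix : ∀ m : M, (∀ a ∈ A, a • m = m) → m = 0)
    {m m' : M} (h : ∀ a : A, (a : G) • m - m = (a : G) • m' - m') : m = m' := by
  rw [← sub_eq_zero]
  refine hfix (m - m') fun a ha ↦ ?_
  have e := h ⟨a, ha⟩
  rw [smul_sub]
  -- `a•m - m = a•m' - m'` ⟹ `a•m - a•m' = m - m'`
  have : (a : G) • m - (a : G) • m' = m - m' := by
    have e' : (a : G) • m = (a : G) • m' - m' + m := by rw [← e, sub_add_cancel]
    rw [e']; abel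
  exact this

omit [IsTopologicalGroup G] in
/-- A continuous crossed homomorphism satisfies `z(g⁻¹) = −g⁻¹·z(g)`. [cite: SerreGaloisCohomology1997, I.§5.1] -/
theorem contOneCocycles_apply_inv {A : Subgroup G} (z : contOneCocycles (discreteTopRep A M)) (g : A) :
    z.1 g⁻¹ = -((g⁻¹ : A) • z.1 g) := by
  have h := z.2 g⁻¹ g
  rw [inv_mul_cancel, contOneCocycles.apply_one, discreteTopRep_ρ_apply] at h
  exact eq_neg_of_add_eq_zero_left h.symm

/-- **Restriction is onto the invariants when the subgroup has no fixed points.** Let `A ≤ B` be subgroups of a topological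
group `G` with `A` normal in `G` and relatively open in `B`, and `M` a discrete `G`-module with `M^A = 0`. Then every class
`y ∈ H¹(A, M)` with `conj_g y = y` for all `g ∈ B` is `res x` for some `x ∈ H¹(B, M)`. (Inflation–restriction:
`H¹(B, M) → H¹(A, M)^{B/A} → H²(B/A, M^A) = 0`; proved directly on cocycles — for a cocycle `z` of `y` and `g ∈ B` the
invariance gives a UNIQUE `m_g` with `g·z(g⁻¹ a g) − z(a) = a·m_g − m_g`, and `g ↦ m_g` is a continuous cocycle on `B`
extending `z`.) No hypothesis on `[B : A]`. [cite: SerreLocalFields1979, VII.§6 Prop. 5] [cite: SerreGaloisCohomology1997, I.§2.6(b)] -/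
theorem exists_resOfLe_eq_of_forall_conjH1_eq_of_fixed_eq_zero {A B : Subgroup G} [A.Normal] (h : A ≤ B)
    (hA : IsOpen (A.subgroupOf B : Set B)) (hfix : ∀ m : M, (∀ a ∈ A, a • m = m) → m = 0)
    {y : subgroupH1 A M} (hy : ∀ g : B, conjH1 A M (g : G) y = y) :
    ∃ x : subgroupH1 B M, resOfLe M h x = y := by
  obtain ⟨z, rfl⟩ := oneCocycleClass_surjective _ y
  -- `conj_g` on cocycles
  have hconj : ∀ g : G, conjH1 A M g (oneCocycleClass _ z) =
      oneCocycleClass _ (contOneCocycles.pullback (subgroupConj A g)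
        (resHomOfEquivariant (subgroupConj A g) (DistribSMul.toAddMonoidHom M g) (conj_compat A g)) z) :=
    fun g ↦ map_oneCocycleClass _ _ _ z
  -- invariance: the coboundary witnesses `m_g`
  have hex : ∀ g : B, ∃ m : M, ∀ a : A, (g : G) • z.1 (subgroupConj A (g : G) a) - z.1 a = (a : G) • m - m := by
    intro g
    have h0 := hy g
    rw [hconj, ← sub_eq_zero, ← oneCocycleClass_sub, oneCocycleClass_eq_zero_iff] at h0
    obtain ⟨m, hm⟩ := h0
    refine ⟨m, fun a ↦ ?_⟩
    have h1 := hm a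
    rw [Submodule.coe_sub, ContinuousMap.sub_apply, contOneCocycles.pullback_apply] at h1
    exact h1
  choose μ hμ using hex
  -- (i) on `A`, `m_a = z(a)`
  have hμA : ∀ (a₀ : A) (ha₀ : ((a₀ : A) : G) ∈ B), μ ⟨a₀, ha₀⟩ = z.1 a₀ := by
    intro a₀ ha₀
    refine eq_of_forall_smul_sub_eq hfix fun a ↦ ?_
    rw [← hμ ⟨a₀, ha₀⟩ a]
    -- `a₀ • z(a₀⁻¹ a a₀) - z a = a • z a₀ - z a₀`
    have hc : subgroupConj A ((a₀ : A) : G) a = a₀⁻¹ * a * a₀ := Subtype.ext (by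
      rw [subgroupConj_apply_coe, Subgroup.coe_mul, Subgroup.coe_mul, Subgroup.coe_inv])
    change ((a₀ : A) : G) • z.1 (subgroupConj A ((a₀ : A) : G) a) - z.1 a = (a : G) • z.1 a₀ - z.1 a₀
    rw [hc, z.2 (a₀⁻¹ * a) a₀, z.2 a₀⁻¹ a, contOneCocycles_apply_inv, discreteTopRep_ρ_apply, discreteTopRep_ρ_apply,
      Subgroup.smul_def, Subgroup.smul_def, Subgroup.smul_def, Subgroup.coe_mul, Subgroup.coe_inv, smul_add, smul_add,
      smul_neg, mul_smul]
    simp only [smul_inv_smul]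
    abel
  -- (ii) the cocycle identity `m_{gh} = m_g + g • m_h`
  have hμmul : ∀ g g' : B, μ (g * g') = μ g + (g : G) • μ g' := by
    intro g g'
    refine eq_of_forall_smul_sub_eq hfix fun a ↦ ?_
    rw [← hμ (g * g') a]
    -- `conj_{gg'} a = conj_{g'} (conj_g a)`
    have hc : subgroupConj A ((g * g' : B) : G) a = subgroupConj A (g' : G) (subgroupConj A (g : G) a) := by
      rw [Subgroup.coe_mul, ← subgroupConj_comp]; rfl
    set a' := subgroupConj A (g : G) a with ha'
    have h1 := hμ g' a'
    have h2 := hμ g a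
    -- `g' • z(conj_{g'} a') = z a' + a' • μ g' - μ g'`
    have h1' : (g' : G) • z.1 (subgroupConj A (g' : G) a') = z.1 a' + ((a' : G) • μ g' - μ g') := by
      rw [← h1]; abel
    have h2' : (g : G) • z.1 a' = z.1 a + ((a : G) • μ g - μ g) := by
      rw [← h2]; abel
    -- `g • (a' • m) = a • (g • m)` since `g a' = a g`
    have hga : ∀ m : M, (g : G) • ((a' : G) • m) = (a : G) • ((g : G) • m) := fun m ↦ by
      rw [smul_smul, smul_smul, ha', subgroupConj_apply_coe, ← mul_assoc, ← mul_assoc, mul_inv_cancel, one_mul]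
    rw [hc, Subgroup.coe_mul, mul_smul, h1', smul_add, smul_sub, h2', hga, smul_add]
    abel
  -- (iii) continuity: `g ↦ m_g` is locally constant (`m_{g₀ a} = m_{g₀}` when `z(a) = 0`, `A` relatively open in `B`)
  let bfun : B → M := μ
  have hV : IsOpen (Subtype.val '' {b : ↥(A.subgroupOf B) | z.1 ⟨((b : B) : G), b.2⟩ = 0} : Set B) := by
    have hz : Continuous fun b : ↥(A.subgroupOf B) ↦ z.1 ⟨((b : B) : G), b.2⟩ :=
      z.1.continuous.comp (Continuous.subtype_mk (continuous_subtype_val.comp continuous_subtype_val) _)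
    have hU : IsOpen {b : ↥(A.subgroupOf B) | z.1 ⟨((b : B) : G), b.2⟩ = 0} :=
      (isOpen_discrete ({0} : Set M)).preimage hz
    exact hA.isOpenMap_subtype_val _ hU
  have hcontb : Continuous bfun := by
    refine IsLocallyConstant.continuous ((IsLocallyConstant.iff_exists_open bfun).mpr fun x ↦ ?_)
    refine ⟨(fun y : B ↦ x⁻¹ * y) ⁻¹'
      (Subtype.val '' {b : ↥(A.subgroupOf B) | z.1 ⟨((b : B) : G), b.2⟩ = 0}), ?_, ?_, ?_⟩
    · exact hV.preimage (continuous_const.mul continuous_id)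
    · refine ⟨⟨1, by rw [Subgroup.mem_subgroupOf, Subgroup.coe_one]; exact one_mem _⟩, ?_, ?_⟩
      · change z.1 ⟨((1 : B) : G), _⟩ = 0
        have : (⟨((1 : B) : G), (by rw [Subgroup.coe_one]; exact one_mem A)⟩ : A) = 1 := Subtype.ext rfl
        rw [this, contOneCocycles.apply_one]
      · change ((⟨1, _⟩ : ↥(A.subgroupOf B)) : B) = x⁻¹ * x
        rw [inv_mul_cancel]
    · rintro y ⟨b, hb0, hb⟩
      -- `y = x * b` with `b ∈ A`, `z b = 0`
      have hy' : y = x * (b : B) := by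
        have : (b : B) = x⁻¹ * y := hb
        rw [this, mul_inv_cancel_left]
      change μ y = μ x
      rw [hy', hμmul, hμA ⟨((b : B) : G), b.2⟩ (b : B).2]
      have hb0' : z.1 ⟨((b : B) : G), b.2⟩ = 0 := hb0
      rw [hb0', smul_zero, add_zero]
  -- (iv) the extension and its restriction
  refine ⟨oneCocycleClass _ ⟨⟨bfun, hcontb⟩, fun g g' ↦ hμmul g g'⟩, ?_⟩
  have hres : resOfLe M h (oneCocycleClass _ ⟨⟨bfun, hcontb⟩, fun g g' ↦ hμmul g g'⟩) =
      oneCocycleClass _ (contOneCocycles.pullback (subgroupInclusion h)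
        (resHomOfEquivariant (subgroupInclusion h) (AddMonoidHom.id M) (fun _ _ ↦ rfl))
          ⟨⟨bfun, hcontb⟩, fun g g' ↦ hμmul g g'⟩) :=
    map_oneCocycleClass _ _ _ _
  rw [hres]
  congr 1
  apply Subtype.ext
  ext a
  rw [contOneCocycles.pullback_apply]
  exact hμA a (h a.2)

omit [TopologicalSpace G] [IsTopologicalGroup G] [TopologicalSpace M] [DiscreteTopology M] in
/-- **`M^K = 0 ⟹ M^{K ∩ N} = 0` for an elementary abelian `2`-group `M` and a subgroup `N ≤ G` of index `2`.** If `K ≤ N` there is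
nothing to do; else pick `σ ∈ K ∖ N`; for `m` fixed by `K ∩ N`: if `σ m = m` then `m` is fixed by `K = (K ∩ N) ∪ σ(K ∩ N)`, so
`m = 0`; otherwise `u = m + σ m ≠ 0` is fixed by `K ∩ N` (normality of `N`), by `σ` (`σ² ∈ N`), hence by `K` — contradiction.
(The `2`-group `K/(K ∩ N)` acting on the `2`-group `M^{K ∩ N}`.) [cite: GreenbergLNM1716, §1 p. 62 (the fixed-point principle)] -/
theorem eq_zero_of_forall_inf_smul_eq_of_index_two (h2 : ∀ m : M, m + m = 0) (K N : Subgroup G) (hN : N.index = 2)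
    (hK : ∀ m : M, (∀ g ∈ K, g • m = m) → m = 0) (m : M) (hm : ∀ g ∈ K ⊓ N, g • m = m) : m = 0 := by
  haveI : N.Normal := Subgroup.normal_of_index_eq_two hN
  by_cases hKN : K ≤ N
  · exact hK m fun g hg ↦ hm g (Subgroup.mem_inf.mpr ⟨hg, hKN hg⟩)
  · obtain ⟨σ, hσK, hσN⟩ := Set.not_subset.mp hKN
    -- every `τ ∈ K` is in `K ∩ N` or in `σ (K ∩ N)`
    have hKfix : ∀ u : M, (∀ g ∈ K ⊓ N, g • u = u) → σ • u = u → ∀ τ ∈ K, τ • u = u := by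
      intro u hu hσu τ hτ
      by_cases hτN : τ ∈ N
      · exact hu τ (Subgroup.mem_inf.mpr ⟨hτ, hτN⟩)
      · have hστ : σ⁻¹ * τ ∈ N := by
          rw [Subgroup.mul_mem_iff_of_index_two hN, inv_mem_iff]
          exact iff_of_false hσN hτN
        have hστK : σ⁻¹ * τ ∈ K := mul_mem (inv_mem hσK) hτ
        have e : τ = σ * (σ⁻¹ * τ) := by rw [mul_inv_cancel_left]
        rw [e, mul_smul, hu _ (Subgroup.mem_inf.mpr ⟨hστK, hστ⟩), hσu]
    by_cases hσm : σ • m = m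
    · exact hK m (hKfix m hm hσm)
    · exfalso
      set u := m + σ • m with hu
      have hu0 : u ≠ 0 := by
        intro h0
        apply hσm
        -- `m + σ m = 0` ⟹ `σ m = -m = m`
        have e1 : σ • m = -m := (neg_eq_of_add_eq_zero_right h0).symm
        have e2 : -m = m := by rw [neg_eq_iff_add_eq_zero, h2]
        rw [e1, e2]
      -- `u` is fixed by `K ∩ N`
      have huKN : ∀ g ∈ K ⊓ N, g • u = u := by
        intro g hg
        obtain ⟨hgK, hgN⟩ := Subgroup.mem_inf.mp hg
        have hconj : σ⁻¹ * g * σ ∈ K ⊓ N :=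
          Subgroup.mem_inf.mpr ⟨mul_mem (mul_mem (inv_mem hσK) hgK) hσK, by
            simpa only [inv_inv, mul_assoc] using (inferInstance : N.Normal).conj_mem g hgN σ⁻¹⟩
        rw [hu, smul_add, hm g hg]
        congr 1
        calc g • σ • m = σ • ((σ⁻¹ * g * σ) • m) := by
              rw [mul_smul, mul_smul, smul_inv_smul]
          _ = σ • m := by rw [hm _ hconj]
      -- `u` is fixed by `σ` (`σ² ∈ K ∩ N`)
      have hσ2 : σ * σ ∈ K ⊓ N := Subgroup.mem_inf.mpr ⟨mul_mem hσK hσK, Subgroup.mul_self_mem_of_index_two hN σ⟩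
      have hσu : σ • u = u := by
        rw [hu, smul_add, smul_smul, hm _ hσ2, add_comm]
      exact hu0 (hK u (hKfix u huKN hσu))

end Generic

/-! ## §2. The habitat instance: `H¹(Γ_{ℚ_∞}, W[2]) ⥲ H¹(Γ_{ℚ_∞} ∩ N, W[2])^{Γ_{ℚ_∞}}` -/

section Habitat

open Field Literature.NumberTheory.EllipticCurves.Rank1Residual

variable (W : WeierstrassCurve ℚ) [W.IsElliptic] [W.IsGloballyMinimal]

/-- **`W[2]^{Γ_{ℚ_∞} ∩ N} = 0`** on the habitat, for every `ℤ₂`-extension `κ` of `ℚ` and every subgroup `N ≤ Γ_ℚ` of index `2`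
(e.g. `N = Γ_K`, `K = ℚ(√Δ_W)`, so that `Γ_{ℚ_∞} ∩ N = Γ_{K·ℚ_∞}`): from `W[2]^{Γ_{ℚ_∞}} = 0` (g9's
`eq_zero_of_forall_kerSubgroup_smul_eq`, p613876) by `eq_zero_of_forall_inf_smul_eq_of_index_two`.
[cite: GreenbergLNM1716, §1 p. 62; §4 p. 109] -/
theorem eq_zero_of_forall_kerSubgroup_inf_smul_eq (hss : GoodSS W 2) (κ : ZpExtension ℚ 2)
    (N : Subgroup (absoluteGaloisGroup ℚ)) (hN : N.index = 2)
    (m : ↥((↥(W.geomPrimaryTorsion 2))[(2 : ℤ)])) (hm : ∀ g ∈ κ.kerSubgroup ⊓ N, g • m = m) : m = 0 :=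
  eq_zero_of_forall_inf_smul_eq_of_index_two
    (fun x ↦ by have := AddSubgroup.torsionBy.nsmul x; rwa [two_nsmul] at this)
    κ.kerSubgroup N hN (fun x hx ↦ eq_zero_of_forall_kerSubgroup_smul_eq W hss κ x hx) m hm

/-- **`res : H¹(Γ_{ℚ_∞}, W[2]) → H¹(Γ_{ℚ_∞} ∩ N, W[2])` is injective** on the habitat (`N ≤ Γ_ℚ` normal of index `2`, `κ` any
`ℤ₂`-extension): inflation–restriction with `W[2]^{Γ_{ℚ_∞} ∩ N} = 0` (tree tool `resOfLe_injective_of_forall_fixed_eq_zero`).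
[cite: GreenbergLNM1716, §3 Lemma 3.1] [cite: SerreLocalFields1979, VII.§6 Prop. 4] -/
theorem resOfLe_kerSubgroup_inf_injective (hss : GoodSS W 2) (κ : ZpExtension ℚ 2)
    (N : Subgroup (absoluteGaloisGroup ℚ)) [N.Normal] (hN : N.index = 2) :
    Function.Injective (resOfLe ↥((↥(W.geomPrimaryTorsion 2))[(2 : ℤ)])
      (inf_le_left : κ.kerSubgroup ⊓ N ≤ κ.kerSubgroup)) := by
  exact resOfLe_injective_of_forall_fixed_eq_zero inf_le_left
    (fun m hm ↦ eq_zero_of_forall_kerSubgroup_inf_smul_eq W hss κ N hN m hm)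

/-- **… and onto the `Γ_{ℚ_∞}`-invariant classes** (`N` open of index `2`): every `y ∈ H¹(Γ_{ℚ_∞} ∩ N, W[2])` with
`conj_g y = y` for all `g ∈ Γ_{ℚ_∞}` is a restriction from `H¹(Γ_{ℚ_∞}, W[2])` — `H²(C₂, W[2]^{Γ_{ℚ_∞} ∩ N}) = H²(C₂, 0) = 0`
(`exists_resOfLe_eq_of_forall_conjH1_eq_of_fixed_eq_zero`). [cite: SerreLocalFields1979, VII.§6 Prop. 5]
[cite: SerreGaloisCohomology1997, I.§2.6(b)] -/
theorem exists_resOfLe_kerSubgroup_inf_eq_of_forall_conjH1_eq (hss : GoodSS W 2) (κ : ZpExtension ℚ 2)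
    (N : Subgroup (absoluteGaloisGroup ℚ)) [N.Normal] (hN : N.index = 2) (hNo : IsOpen (N : Set (absoluteGaloisGroup ℚ)))
    {y : subgroupH1 (κ.kerSubgroup ⊓ N) ↥((↥(W.geomPrimaryTorsion 2))[(2 : ℤ)])}
    (hy : ∀ g : κ.kerSubgroup, conjH1 (κ.kerSubgroup ⊓ N) ↥((↥(W.geomPrimaryTorsion 2))[(2 : ℤ)]) (g : absoluteGaloisGroup ℚ) y = y) :
    ∃ x : subgroupH1 κ.kerSubgroup ↥((↥(W.geomPrimaryTorsion 2))[(2 : ℤ)]),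
      resOfLe ↥((↥(W.geomPrimaryTorsion 2))[(2 : ℤ)]) (inf_le_left : κ.kerSubgroup ⊓ N ≤ κ.kerSubgroup) x = y := by
  refine exists_resOfLe_eq_of_forall_conjH1_eq_of_fixed_eq_zero inf_le_left ?_
    (fun m hm ↦ eq_zero_of_forall_kerSubgroup_inf_smul_eq W hss κ N hN m hm) hy
  -- `(Γ_{ℚ_∞} ∩ N) ∩ Γ_{ℚ_∞}` is open in `Γ_{ℚ_∞}`: it is the preimage of the open `N`
  have : ((κ.kerSubgroup ⊓ N).subgroupOf κ.kerSubgroup : Set κ.kerSubgroup) = Subtype.val ⁻¹' (N : Set (absoluteGaloisGroup ℚ)) := by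
    ext g
    simp only [SetLike.mem_coe, Subgroup.mem_subgroupOf, Subgroup.mem_inf, Set.mem_preimage]
    exact ⟨fun h ↦ h.2, fun h ↦ ⟨g.2, h⟩⟩
  rw [this]
  exact hNo.preimage continuous_subtype_val

/-- **Packaged: `res : H¹(Γ_{ℚ_∞}, W[2]) → H¹(Γ_{ℚ_∞} ∩ N, W[2])` is a BIJECTION onto the `Γ_{ℚ_∞}`-invariant classes** (habitat
`W`, any `ℤ₂`-extension `κ`, any open normal `N ≤ Γ_ℚ` of index `2`). With `N = Γ_K`, `K = ℚ(√Δ_W)`: `H¹(ℚ_∞, W[2]) ≅ H¹(K_∞, W[2])^{Gal(K_∞/ℚ_∞)}`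
— the global half of the transfer step (T1) of the CM-endpoint cards on `(R≥)ᵖ` (item stmt-BirchSwinnertonDyer-26074).
[cite: SerreLocalFields1979, VII.§6 Prop. 4–5] [cite: GreenbergLNM1716, §3 Lemma 3.1] -/
theorem resOfLe_kerSubgroup_inf_bijective_invariants (hss : GoodSS W 2) (κ : ZpExtension ℚ 2)
    (N : Subgroup (absoluteGaloisGroup ℚ)) [N.Normal] (hN : N.index = 2) (hNo : IsOpen (N : Set (absoluteGaloisGroup ℚ))) :
    Set.BijOn (resOfLe ↥((↥(W.geomPrimaryTorsion 2))[(2 : ℤ)]) (inf_le_left : κ.kerSubgroup ⊓ N ≤ κ.kerSubgroup))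
      Set.univ
      {y | ∀ g : κ.kerSubgroup,
        conjH1 (κ.kerSubgroup ⊓ N) ↥((↥(W.geomPrimaryTorsion 2))[(2 : ℤ)]) (g : absoluteGaloisGroup ℚ) y = y} := by
  refine ⟨fun x _ ↦ ?_, fun x _ x' _ hxx' ↦ resOfLe_kerSubgroup_inf_injective W hss κ N hN hxx', fun y hy ↦ ?_⟩
  · -- restrictions are invariant: `conj_g ∘ res = res ∘ conj_g` and `conj_g = id` on `H¹(Γ_{ℚ_∞}, ·)` for `g ∈ Γ_{ℚ_∞}`
    intro g
    rw [← AddMonoidHom.comp_apply, ← resOfLe_comp_conjH1_holds, AddMonoidHom.comp_apply,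
      conjH1_of_mem_holds κ.kerSubgroup _ g.2, AddMonoidHom.id_apply]
  · obtain ⟨x, hx⟩ := exists_resOfLe_kerSubgroup_inf_eq_of_forall_conjH1_eq W hss κ N hN hNo hy
    exact ⟨x, Set.mem_univ _, hx⟩

end Habitat

/-! ## §3. The injectivity half under RELATIVE normality (card `character-side-signed-transport`, First lemma verbatim) -/

section RelativeNormal

variable {G : Type u} [Group G] [TopologicalSpace G] [IsTopologicalGroup G]
  {M : Type u} [AddCommGroup M] [DistribMulAction G M] [TopologicalSpace M] [DiscreteTopology M]

/-- **Inflation–restriction, injectivity half, with only RELATIVE normality**: for subgroups `A ≤ B` of a topological group `G` with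
`A` normalised by `B` (`b a b⁻¹ ∈ A` for `b ∈ B`, `a ∈ A`) and a discrete `G`-module `M` with `M^A = 0`, the restriction
`res : H¹(B, M) → H¹(A, M)` is injective. Same cocycle argument as the tree's `resOfLe_injective_of_forall_fixed_eq_zero` (which asks
`A` normal in `G`). [cite: SerreLocalFields1979, VII.§6 Prop. 4] [cite: GreenbergLNM1716, §3 Lemma 3.1] -/
theorem resOfLe_injective_of_forall_fixed_eq_zero_of_relNormal {A B : Subgroup G} (hle : A ≤ B)
    (hrel : ∀ b ∈ B, ∀ a ∈ A, b * a * b⁻¹ ∈ A) (hfix : ∀ m : M, (∀ a ∈ A, a • m = m) → m = 0) :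
    Function.Injective (resOfLe M hle) := by
  rw [injective_iff_map_eq_zero]
  intro c hc
  obtain ⟨z, rfl⟩ := oneCocycleClass_surjective _ c
  obtain ⟨a, ha⟩ := (CocycleCriteria.resOfLe_oneCocycleClass_eq_zero_iff hle z).mp hc
  rw [oneCocycleClass_eq_zero_iff]
  refine ⟨a, fun h ↦ ?_⟩
  change z.1 h = (h : G) • a - a
  rw [← sub_eq_zero]
  refine hfix _ fun x hx ↦ ?_
  have hy : (h : G)⁻¹ * x * h ∈ A := by
    simpa only [inv_inv] using hrel _ (inv_mem h.2) x hx
  set xH : B := ⟨x, hle hx⟩ with hxH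
  set yH : B := ⟨(h : G)⁻¹ * x * h, hle hy⟩ with hyH
  have hmul : xH * h = h * yH := Subtype.ext (by
    simp only [hxH, hyH, Subgroup.coe_mul, ← mul_assoc, mul_inv_cancel, one_mul])
  have hzx : z.1 xH = x • a - a := ha ⟨x, hx⟩
  have hzy : z.1 yH = ((h : G)⁻¹ * x * h) • a - a := ha ⟨(h : G)⁻¹ * x * h, hy⟩
  have e1 : z.1 (xH * h) = (x • a - a) + x • z.1 h := by
    rw [z.2 xH h, hzx]
    rfl
  have e2 : z.1 (xH * h) = z.1 h + ((x • ((h : G) • a)) - (h : G) • a) := by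
    rw [hmul, z.2 h yH, hzy]
    change z.1 h + (h : G) • (((h : G)⁻¹ * x * h) • a - a) = _
    rw [smul_sub, smul_smul, ← mul_assoc, ← mul_assoc, mul_inv_cancel, one_mul, mul_smul]
  have e := eq_sub_of_add_eq' (e1.symm.trans e2)
  rw [smul_sub, smul_sub, e]
  abel

end RelativeNormal

/-- **`InfResInjective`** — First lemma of the crux idea card `character-side-signed-transport` on item stmt-BirchSwinnertonDyer-26074,
VERBATIM: for `H ≤ H' ≤ Γ_ℚ` with `H` normalised by `H'` and a discrete `Γ_ℚ`-module `M` with `M^H = 0`, `res : H¹(H', M) → H¹(H, M)` is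
injective (applied with `H' = Γ_{ℚ_∞}`, `H = Γ_{K_∞}`, `M = W[2]`). [cite: SerreLocalFields1979, VII.§6 Prop. 4] -/
theorem infResInjective : ∀ (M : Type) [AddCommGroup M] [DistribMulAction (Field.absoluteGaloisGroup ℚ) M] [TopologicalSpace M]
    [DiscreteTopology M] (H H' : Subgroup (Field.absoluteGaloisGroup ℚ)) (h : H ≤ H'),
    (∀ g ∈ H', ∀ x ∈ H, g * x * g⁻¹ ∈ H) → (∀ m : M, (∀ σ ∈ H, σ • m = m) → m = 0) →
      Function.Injective (Literature.NumberTheory.EllipticCurves.resOfLe M h) :=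
  fun _ _ _ _ _ _ _ h hrel hfix ↦ resOfLe_injective_of_forall_fixed_eq_zero_of_relNormal h hrel hfix

end Summit.BirchSwinnertonDyer.BirchSwinnertonDyer.Theorems.ResidualLayer

end
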